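import Summits.BirchSwinnertonDyer.BirchSwinnertonDyer.Theorems.KolyvaginDepthDoorMSymbolCert817a1K
import HarnessLib

/-!
# Route `KolyvaginDepthDoor`, crux `KolyvaginDepthSupplyKN` (stmt-BirchSwinnertonDyer-22820) —
# DEPTH TABLE v28, DATA of `817a1`: piece 1/2 of the Kurihara sum at `(5, 12431)`

Helper file of the lead prover of line `levelone` (kdd-p1 g33; `--supports stmt-BirchSwinnertonDyer-22820 --as helper`);
MACHINE-WRITTEN DATA + `decide` (generator `work/py/gen817lean.py`). Kernel evaluation of `∑_{8183 ≤ k < 12431} gE817 k` (212817 continued-fraction steps, three `decide` sub-chunks). It closes nothing and BSD is NOT proved by it.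

References: [CremonaAlgorithms1997] §2.2–2.5, §2.8, Table 1 (817a1); [PopaZagier2017] §4 (13); [Kim2022StructureSelmer] §1.4.3;
[MazurTateTeitelbaum1986Invent] §I.8.
-/

set_option linter.dupNamespace false
-- the packed numerals are long literals
set_option linter.style.longLine false

noncomputable section

open scoped MatrixGroups ModularForm
open CongruenceSubgroup
open Literature.NumberTheory.EllipticCurves Literature.NumberTheory.EllipticCurves.ModularForms
open Literature.NumberTheory.Automorphic.PopaZagier (coeff12 coeff12M coeff coeffN)
open Summit.BirchSwinnertonDyer.BirchSwinnertonDyer.Rank2Observatory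
open Summit.BirchSwinnertonDyer.BirchSwinnertonDyer.Rank1Residual (IntModel.frobeniusTrace_eq IntModel.minimalDiscriminantInt_eq)
open Summit.BirchSwinnertonDyer.BirchSwinnertonDyer.Theorems.KolyvaginDepthDoor.MSymbolCert.Cert389a1
  (H3 H3fin support_subset_H3fin H3fin_det H3mat_nodup H3_det H3_coeff eval_map eval_append)

namespace Summit.BirchSwinnertonDyer.BirchSwinnertonDyer.Theorems.KolyvaginDepthDoor.MSymbolCert.Cert817a1

set_option maxHeartbeats 4000000 in
/-- **Piece 1 of the Kurihara sum of `817a1` at `(5, 12431)`**: `∑_{8183 ≤ k < 12431} gE817 k = 3` in `ZMod 5` (decide). [cite: Kim2022StructureSelmer, §1.4.3] -/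
theorem kSumPiece1 : ((List.range' 8183 4248).map gE817).sum = ((3 : ℕ) : ZMod 5) := by
  have h0 : ((List.range' 8183 2217).map gE817).sum = ((4 : ℕ) : ZMod 5) := by decide +kernel
  have h1 : ((List.range' (8183 + 2217) 1873).map gE817).sum = ((3 : ℕ) : ZMod 5) := by decide +kernel
  have h2 : ((List.range' (8183 + (2217 + 1873)) 158).map gE817).sum = ((1 : ℕ) : ZMod 5) := by decide +kernel
  have e := zmod5_range'_map_sum_split gE817 8183 (2217 + 1873) 158 _ _ (zmod5_range'_map_sum_split gE817 8183 2217 1873 _ _ h0 h1) h2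
  refine (show ((List.range' 8183 4248).map gE817).sum = ((List.range' 8183 (2217 + 1873 + 158)).map gE817).sum from rfl).trans
    (e.trans ?_)
  decide

end Summit.BirchSwinnertonDyer.BirchSwinnertonDyer.Theorems.KolyvaginDepthDoor.MSymbolCert.Cert817a1

end
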